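import Summits.MatrixMultiplication.MatrixMultiplication.Theorems.SoloInformedPoorRows
import Summits.MatrixMultiplication.MatrixMultiplication.Theorems.SoloInformedTranspose
import Summits.MatrixMultiplication.MatrixMultiplication.Theorems.SoloInformedResidualWorld

/-!
# THEOREM 8.22 (C3, `m = 2` coprime, every chart) as ONE kernel theorem: `n³ ≤ 213073920 · r·|S⁰|`

This work, §8.8 (T13) and C3-m2 §6 (gen 108: the kernel glue closes). Setting: a CU13-Def-12 realization of
`⟨n,n,n⟩` in `𝒮(S⁰ × S¹, ±)` with `S¹` of odd order [CohnUmans2013, arXiv:1207.6528, Def. 12], in the abstract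
form used throughout: equation data `D : Data ι G` over a finite abelian group `G` without 2-torsion
(`x = −x → x = 0`), a chart `Φ = (f, g, l) : ι → S⁰` with full separation of every fibre, and an exact class map
`κ : G → R` (`κ x = κ y ⟺ x ∼ y`); the rank of the realization is `r·|S⁰| = |R|·|G₀|`.

`Data.cube_le_of_sepAll`: `n³ ≤ 213073920 · (|R|·|G₀|)`. Hence the rank of every such realization is at least
`2⁻²⁸·n³` — door D13 (Cohn–Umans adjacency) cannot reach `ω < 3` exponent bounds through realizations of a single
`⟨n,n,n⟩` with `m = 2` coprime parts, whatever the chart. (A no-go theorem; it does not bear on `ω` itself.)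
Proof: `Data.cube_le_or_residual` (THEOREM 8.21*, the rich worlds, kernel since gen 107) leaves the residual poor
world, where at least half of the indices carry a poor row of `b` (THEOREM 8.20, `Data.poor_rows_cube_le`) or a
poor column of `a` (THEOREM 8.20′ = THEOREM 8.20 for the transposed realization `Data.transpose`,
`Data.sepAll_transpose`).
-/

namespace Summit.MatrixMultiplication.MatrixMultiplication.Theorems.TwistedTPP

namespace FibreLines

variable {ι G : Type*} [AddCommGroup G]
variable {G₀ : Type*} [AddCommGroup G₀] {R : Type*}

/-- **THEOREM 8.20′ (every chart).** A family `J_p` of columns of `a` with `n ≤ 2|J_p|`, each taking at most `17`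
values, forces `n³ ≤ 213073920 · (r·|S⁰|)` — THEOREM 8.20 for the transposed realization.
[this work §8.8 (T12)(g), (T13); C3-m2 §5.3] -/
theorem Data.poor_cols_cube_le [Fintype ι] [DecidableEq ι] [Fintype G₀] [DecidableEq G₀] [Fintype R]
    [DecidableEq R] [DecidableEq G] (hG : ∀ x : G, x = -x → x = 0) (D : Data ι G) (Φ : Chart ι G₀)
    (κ : G → R) (hκ : ∀ x y, κ x = κ y → SignEq x y) (hsep : D.SepAll Φ) (Jp : Finset ι)
    (hJp : Fintype.card ι ≤ 2 * Jp.card)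
    (hpoor : ∀ j ∈ Jp, ((Finset.univ : Finset ι).image fun i => D.a i j).card ≤ 17) :
    Fintype.card ι ^ 3 ≤ 213073920 * (Fintype.card R * Fintype.card G₀) :=
  D.transpose.poor_rows_cube_le hG Φ.transpose κ hκ (D.sepAll_transpose hsep) Jp hJp fun j hj => by
    rw [Data.transpose_b_row]; exact hpoor j hj

/-- **THEOREM 8.22 (C3 for `m = 2` coprime, every chart; one kernel theorem).** For every fully separated
realization (equation data without 2-torsion, any chart, exact class map), `n³ ≤ 213073920 · (|R|·|S⁰|)`:
the rank `r·|S⁰|` is at least `2⁻²⁸ n³`. [this work §8.8 (T13); C3-m2 §6; CohnUmans2013 Def. 12] -/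
theorem Data.cube_le_of_sepAll [Fintype ι] [DecidableEq ι] [Fintype G₀] [DecidableEq G₀] [Fintype G]
    [DecidableEq G] [Fintype R] [DecidableEq R] (hG : ∀ x : G, x = -x → x = 0) (D : Data ι G)
    (Φ : Chart ι G₀) (κ : G → R) (hκ : ∀ x y, κ x = κ y ↔ SignEq x y) (hsep : D.SepAll Φ) :
    Fintype.card ι ^ 3 ≤ 213073920 * (Fintype.card R * Fintype.card G₀) := by
  classical
  set n := Fintype.card ι with hn
  set M := Fintype.card R * Fintype.card G₀ with hM
  have hκ' : ∀ x y, κ x = κ y → SignEq x y := fun x y => (hκ x y).1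
  rcases Nat.eq_zero_or_pos n with h0 | hpos
  · simp [h0]
  -- THEOREM 8.20 and THEOREM 8.20′
  have h20 : ∀ Jp : Finset ι, n ≤ 2 * Jp.card →
      (∀ j ∈ Jp, ((Finset.univ : Finset ι).image fun k => D.b j k).card ≤ 17) → n ^ 3 ≤ 213073920 * M :=
    fun Jp h1 h2 => D.poor_rows_cube_le hG Φ κ hκ' hsep Jp h1 h2
  have h20' : ∀ Jp : Finset ι, n ≤ 2 * Jp.card →
      (∀ j ∈ Jp, ((Finset.univ : Finset ι).image fun i => D.a i j).card ≤ 17) → n ^ 3 ≤ 213073920 * M :=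
    fun Jp h1 h2 => D.poor_cols_cube_le hG Φ κ hκ' hsep Jp h1 h2
  rcases D.cube_le_or_residual hG Φ κ hκ hsep with h | h | h | ⟨hall, -, -⟩
  · exact h.trans (by omega)
  · -- rich columns of `a`: many ⟹ `n³ ≤ 6M`; few ⟹ half the columns of `a` are poor, THEOREM 8.20′
    set SA : Finset ι := (Finset.univ : Finset ι).filter fun j =>
      17 ≤ ((Finset.univ : Finset ι).image fun i => D.a i j).card with hSA
    set TA : Finset ι := (Finset.univ : Finset ι).filter fun j =>
      ¬ 17 ≤ ((Finset.univ : Finset ι).image fun i => D.a i j).card with hTA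
    have hc : SA.card + TA.card = n := by
      rw [hn, ← Finset.card_univ]; exact Finset.card_filter_add_card_filter_not _
    by_cases hmany : n ≤ 2 * SA.card
    · calc n ^ 3 = n ^ 2 * n := by ring
        _ ≤ n ^ 2 * (2 * SA.card) := Nat.mul_le_mul_left _ hmany
        _ = 2 * (n ^ 2 * SA.card) := by ring
        _ ≤ 2 * (3 * M) := Nat.mul_le_mul_left _ h
        _ ≤ 213073920 * M := by omega
    · exact h20' TA (by omega) fun j hj => by
        have := (Finset.mem_filter.1 hj).2
        omega
  · -- rich rows of `b`: the mirror, THEOREM 8.20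
    set SB : Finset ι := (Finset.univ : Finset ι).filter fun j =>
      17 ≤ ((Finset.univ : Finset ι).image fun k => D.b j k).card with hSB
    set TB : Finset ι := (Finset.univ : Finset ι).filter fun j =>
      ¬ 17 ≤ ((Finset.univ : Finset ι).image fun k => D.b j k).card with hTB
    have hc : SB.card + TB.card = n := by
      rw [hn, ← Finset.card_univ]; exact Finset.card_filter_add_card_filter_not _
    by_cases hmany : n ≤ 2 * SB.card
    · calc n ^ 3 = n ^ 2 * n := by ring
        _ ≤ n ^ 2 * (2 * SB.card) := Nat.mul_le_mul_left _ hmany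
        _ = 2 * (n ^ 2 * SB.card) := by ring
        _ ≤ 2 * (3 * M) := Nat.mul_le_mul_left _ h
        _ ≤ 213073920 * M := by omega
    · exact h20 TB (by omega) fun j hj => by
        have := (Finset.mem_filter.1 hj).2
        omega
  · -- the residual poor world: every index has a poor column of `a` or a poor row of `b`
    set PB : Finset ι := (Finset.univ : Finset ι).filter fun j =>
      ((Finset.univ : Finset ι).image fun k => D.b j k).card ≤ 17 with hPB
    set QB : Finset ι := (Finset.univ : Finset ι).filter fun j =>
      ¬ ((Finset.univ : Finset ι).image fun k => D.b j k).card ≤ 17 with hQB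
    have hc : PB.card + QB.card = n := by
      rw [hn, ← Finset.card_univ]; exact Finset.card_filter_add_card_filter_not _
    by_cases hB : n ≤ 2 * PB.card
    · exact h20 PB hB fun j hj => (Finset.mem_filter.1 hj).2
    · exact h20' QB (by omega) fun j hj => (hall j).resolve_right (Finset.mem_filter.1 hj).2

end FibreLines

end Summit.MatrixMultiplication.MatrixMultiplication.Theorems.TwistedTPP
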